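import Mathlib
import Literature.Computability.AlgebraicComplexity.StandardFamiliesProofs
import Summits.ValiantsHypothesis.ValiantsHypothesis.Theorems.GrenetZeonTwoDimCoefficientsScalingRaySeparable
import Summits.ValiantsHypothesis.ValiantsHypothesis.Theorems.GrenetZeonTwoDimCoefficientsScalingIndexShadowDet
import Summits.ValiantsHypothesis.ValiantsHypothesis.Theorems.GrenetZeonTwoDimCoefficientsScalingIndexHdeg

/-!
# Crux `GrenetZeon.TwoDimCoefficients` (stmt-ValiantsHypothesis-8062), stub `stub_dualUnipotent`:
# scaling-closure — INDEX-`n` PENCILS: `det(1 + t·Y)` separable ⟹ `n³ ≤ 2m²`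

Packaging of the scaling-closure method for index-`n` normal forms `A = A₀(1 − N)`, `Nⁿ = 0` (`B` affine, `det A = c ≠ 0`,
`per_n = α·c + β·tr(adj A·B)`), with no degree hypothesis and no companion bookkeeping left: the ray polynomial is
`R(t) = Σ_k [D_k]_{kn} t^k = c·det(1_m + t·Y)`, `Y = c⁻¹[adj A·B]^top` (✓ `topCompanion_eq`), and
✓ `cube_le_two_mul_sq_of_raySeparable` reads:

* ★★ `cube_le_two_mul_sq_of_index_separable` — if `R = c·det(1 − t·(−Y))` admits a separability certificate
  `a·R + b·R′ = g`, `0 ≠ g ∈ ℂ[z]` (i.e. `det(1_m + t·Y(z))` is squarefree over `ℂ(z)`), then `n³ ≤ 2m²`.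

So on index-`n` pencils the 3/2 rung (crux `DualUnipotentThreeHalves`, constant 2) holds off the locus where
`det(1_m + t·Y(z))`, `Y = (−N)^{n−1}A₀⁻¹B₁` (up to the constant), has a repeated factor — the class where Mignon–Ressayre for
multiple shadow factors (lemma L1′ of memo SEVENTEENTH-HAND.md) is needed.  This covers WILD pencils (no flag), in contrast
to the known triangularisable 3/2.

HONEST FRAMING: a conditional rung on index-`n` pencils; the stub `DualUnipotentBound`, both cruxes and `VP ≠ VNP` remain
open.

References: T. Mignon, N. Ressayre, Int. Math. Res. Not. 2004:79, Thm. 1.1 (via the tree); folklore.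
-/

-- single-conjunct layout `Summits/ValiantsHypothesis/ValiantsHypothesis`: the duplicated namespace
-- component is mandated by the tree.
set_option linter.dupNamespace false
set_option autoImplicit false

noncomputable section

namespace Summit.ValiantsHypothesis.ValiantsHypothesis.Theorems.GrenetZeonTwoDimCoefficients.ScalingClosure

open MvPolynomial Matrix
open Literature.Computability.AlgebraicComplexity
open Summit.ValiantsHypothesis.ValiantsHypothesis.Cruxes.TwoDimCoefficients.DimTwoCases

section IndexSeparable

/-- ★★ **Index-`n` pencils: separable `det(1 + t·Y)` ⟹ `n³ ≤ 2m²`** (`n = k + 3`, `m ≥ 2`).  With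
`P^top_{ij} = [ (adj A·B)_{ij} ]_n` and `R := c·det(1 − t·(−c⁻¹P^top)) ∈ ℂ[z][t]`: a certificate `a·R + b·R′ = g ≠ 0`
gives `n³ ≤ 2m²`. [cite: MignonRessayre2004, Thm. 1.1 — via the tree; folklore] -/
theorem cube_le_two_mul_sq_of_index_separable {k m : ℕ} (A B : AffMat (k + 3) m) (hA : IsAffine A)
    (hB : IsAffine B) (α β c : ℂ) (hc : c ≠ 0) (hβ : β ≠ 0) (hdet : A.det = MvPolynomial.C c)
    (hper : perPoly (Fin (k + 3)) ℂ =
      MvPolynomial.C α * A.det + MvPolynomial.C β * (A.adjugate * B).trace)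
    (hm2 : 2 ≤ m) (A₀ P₀ : Matrix (Fin m) (Fin m) ℂ) (hP₀ : A₀ * P₀ = 1) (N : AffMat (k + 3) m)
    (hN : ∀ i j, (N i j).IsHomogeneous 1) (hNn : N ^ (k + 3) = 0) (hAN : A = A₀.map MvPolynomial.C * (1 - N))
    (Ptop : AffMat (k + 3) m) (htop : ∀ i j, Ptop i j = homogeneousComponent (k + 3) ((A.adjugate * B) i j))
    (a b : Polynomial (MvPolynomial (Fin (k + 3) × Fin (k + 3)) ℂ)) (g : MvPolynomial (Fin (k + 3) × Fin (k + 3)) ℂ)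
    (hg : g ≠ 0)
    (hcert : a * (Polynomial.C (MvPolynomial.C c) *
        (-((MvPolynomial.C c⁻¹ : MvPolynomial (Fin (k + 3) × Fin (k + 3)) ℂ) • Ptop)).charpolyRev) +
      b * Polynomial.derivative (Polynomial.C (MvPolynomial.C c) *
        (-((MvPolynomial.C c⁻¹ : MvPolynomial (Fin (k + 3) × Fin (k + 3)) ℂ) • Ptop)).charpolyRev) =
      Polynomial.C g) :
    (k + 3) ^ 3 ≤ 2 * m ^ 2 := by
  classical
  -- degree bookkeeping of the index-`n` normal form
  have hadj : ∀ i j, (A.adjugate i j).totalDegree ≤ k + 3 - 1 :=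
    totalDegree_adjugate_le_of_index (by omega) A₀ P₀ hP₀ N hN hNn A hAN c hc hdet
  have hP : ∀ i j, ((A.adjugate * B) i j).totalDegree ≤ k + 3 := fun i j =>
    (totalDegree_adjugate_mul_le A B (k + 3 - 1) hadj hB i j).trans (by omega)
  obtain ⟨D, hD⟩ : ∃ D : ℕ → MvPolynomial (Fin (k + 3) × Fin (k + 3)) ℂ, ∀ j, D j =
      (det ((Polynomial.X : Polynomial (MvPolynomial (Fin (k + 3) × Fin (k + 3)) ℂ)) •
        B.map Polynomial.C + A.map Polynomial.C)).coeff j := ⟨_, fun _ => rfl⟩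
  have hdeg : ∀ j, 2 ≤ j → ∀ d, j * (k + 3) < d → homogeneousComponent d (D j) = 0 :=
    hdeg_of_adjugate (by omega) A B hB c hc hdet hadj D hD
  -- the ray polynomial is `c·det(1 − t(−c⁻¹P^top))`
  obtain ⟨Rd, hRd⟩ : ∃ Rd : Polynomial (MvPolynomial (Fin (k + 3) × Fin (k + 3)) ℂ),
      Rd = Polynomial.C (MvPolynomial.C c) *
        (-((MvPolynomial.C c⁻¹ : MvPolynomial (Fin (k + 3) × Fin (k + 3)) ℂ) • Ptop)).charpolyRev := ⟨_, rfl⟩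
  rw [← hRd] at hcert
  have hcoeff : ∀ j, homogeneousComponent (j * (k + 3)) (D j) = Rd.coeff j := by
    intro j
    rw [hRd, Polynomial.coeff_C_mul, hD]
    exact topCompanion_eq A B c hc hdet hP Ptop htop j
  have hper0 : MvPolynomial.C β⁻¹ * perPoly (Fin (k + 3)) ℂ ≠ 0 :=
    mul_ne_zero ((map_ne_zero_iff _ (MvPolynomial.C_injective _ _)).mpr (inv_ne_zero hβ))
      (perPoly_ne_zero (Fin (k + 3)) ℂ)
  have hc1 : Rd.coeff 1 = MvPolynomial.C β⁻¹ * perPoly (Fin (k + 3)) ℂ := by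
    rw [← hcoeff 1, one_mul, hD]
    exact homogeneousComponent_coeff_det_one (by omega) A B α β c hc hβ hdet hper
  have hc0 : Rd.coeff 0 = MvPolynomial.C c := by
    rw [← hcoeff 0, zero_mul, hD, coeff_det_zero, hdet, homogeneousComponent_zero, coeff_C, if_pos rfl]
  have hRd0 : Rd ≠ 0 := by
    intro h
    rw [h, Polynomial.coeff_zero] at hc1
    exact hper0 hc1.symm
  obtain ⟨J, hJdef⟩ : ∃ J, J = Rd.natDegree := ⟨_, rfl⟩
  have hJ1 : 1 ≤ J := by
    rw [hJdef]
    refine Polynomial.le_natDegree_of_ne_zero ?_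
    rw [hc1]
    exact hper0
  have hJtop : homogeneousComponent (J * (k + 3)) (D J) ≠ 0 := by
    rw [hcoeff J, hJdef]
    change Rd.leadingCoeff ≠ 0
    exact Polynomial.leadingCoeff_ne_zero.mpr hRd0
  have hJ : ∀ j, J < j → j ≤ m → homogeneousComponent (j * (k + 3)) (D j) = 0 := fun j hj _ => by
    rw [hcoeff j]
    exact Polynomial.coeff_eq_zero_of_natDegree_lt (by rw [← hJdef]; exact hj)
  -- the explicit form of the ray polynomial coincides with `Rd` (coefficientwise)
  have hexplicit : (Polynomial.C (MvPolynomial.C c) + ∑ e : Fin J,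
      Polynomial.C (homogeneousComponent (((e : ℕ) + 1) * (k + 3)) (D (e + 1))) * Polynomial.X ^ ((e : ℕ) + 1)) = Rd := by
    refine Polynomial.ext fun i => ?_
    rw [Polynomial.coeff_add, Polynomial.coeff_C, Polynomial.finsetSum_coeff]
    simp_rw [Polynomial.coeff_C_mul_X_pow]
    rcases Nat.eq_zero_or_pos i with h0 | hpos
    · subst h0
      rw [if_pos rfl, hc0, Finset.sum_eq_zero (fun e _ => if_neg (by omega)), add_zero]
    · rw [if_neg (by omega), zero_add]
      by_cases hiJ : i ≤ J
      · rw [Finset.sum_eq_single (⟨i - 1, by omega⟩ : Fin J)]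
        · simp only
          rw [if_pos (by omega), show i - 1 + 1 = i by omega, hcoeff]
        · rintro e - he
          rw [if_neg]
          intro h
          apply he
          ext
          simp only
          omega
        · intro h; exact absurd (Finset.mem_univ _) h
      · rw [Finset.sum_eq_zero (fun e _ => if_neg (by have := e.2; omega))]
        exact (Polynomial.coeff_eq_zero_of_natDegree_lt (by rw [← hJdef]; omega)).symm
  refine cube_le_two_mul_sq_of_raySeparable A B hA hB α β c hc hβ hdet hper hm2 D hD hdeg hJ1 hJtop hJ
    a b g hg ?_
  rw [hexplicit]
  exact hcert

end IndexSeparable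

end Summit.ValiantsHypothesis.ValiantsHypothesis.Theorems.GrenetZeonTwoDimCoefficients.ScalingClosure

end
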